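import Summits.Ventures.HSemireg.WedgeHankelRecurrenceGaussChebyshevPell
import Literature.Probability.FitznerVanDerHofstad2017.NbwChebyshevBound

/-!
# Venture HSemireg — **MARKOV-TYPE BOUNDS IN CLOSED FORM** (corollaries of Mathlib's `abs_iterate_derivative_T_real_le`): on `[−1, 1]`, **`|T_n'(x)| ≤ n²`**,
# **`(∏_{l<k}(2l+1)) · |T_n^{(k)}(x)| ≤ ∏_{l<k} (n² − l²)`** (V. A. Markov's extremal values), and with the landed `|U_n(x)| ≤ n + 1` and N443 **`|U_n(x)| ≤ min(n+1, (√(1−x²))⁻¹)`** on `(−1, 1)`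

HONEST FRAMING. Part of the Lean index of the computation cell `pub-hsemireg` (seat p10 gen 47, Sunday typer «UNIFORM-IN-n»).  Real polynomial inequalities only; no variety, no cohomology
theory, no sheaf, no Ext group and no semiregularity map is constructed here; nothing here says that HC / HC_CM / HC_AV holds; no Literature fact (unproved `Prop`) is declared or used.  Custodian
versions as in `WedgeHankelSiegelIdeal` (1/3).
SOURCES (cited).  A. A. Markov (1889) and V. A. Markov (1892), see T. J. Rivlin, *Chebyshev Polynomials* (1990), §2.7 (Markov's inequality; `T_n^{(k)}(1) = ∏_{l<k}(n² − l²)∕(2l+1)`), §1.3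
(`|U_n| ≤ n+1`); Mathlib `Polynomial.Chebyshev.abs_iterate_derivative_T_real_le`, `iterate_derivative_T_eval_one`, `derivative_T_eval_one`, `T_derivative_eq_U`.  Thin COROLLARIES typed here.
PROOF TYPED HERE.  Mathlib's bound `|T_n^{(k)}(x)| ≤ T_n^{(k)}(1)` with the closed values; `Literature.Probability.FitznerVanDerHofstad2017.abs_eval_U_le`; N443 `abs_eval_chebyshevU_real_le`.
DEDUP DISCLOSURE (`rg -n -i 'markov_bound|derivative_T_real_le|abs_eval_U' Summits Literature`, 2026-09-04): the chapter's `Markov*` leaves concern Markov–Stieltjes ∕ monotonicity of zeros, not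
Markov's inequality; `|U_n(x)| ≤ n+1` is LANDED as `Literature.Probability.FitznerVanDerHofstad2017.abs_eval_U_le` (imported, used — not restated; a private copy sits in
`Literature/Analysis/Quadrature/ChebyshevUMoments.lean`); 0 hits for the 3 names below.

WHAT IS IN THE TREE.  Mathlib as listed; `Literature…abs_eval_U_le`; N443 `abs_eval_chebyshevU_real_le`.
THIS FILE (namespace `Summit.Ventures.HSemireg.Wedge.HankelOuter` continued; CHAINED on N443; 0 definitions):
* §1209 `abs_eval_derivative_T_real_le` (`≤ n²`), **`abs_iterate_derivative_T_real_le_explicit`**, `abs_eval_chebyshevU_real_le_min`.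
CAVEATS.  Nothing Ext-side.  New names only.
-/

open Module Polynomial
open scoped Matrix Polynomial

namespace Summit.Ventures.HSemireg.Wedge.HankelOuter

/-! ## §1209. Markov-type bounds -/

/-- **`|T_n'(x)| ≤ n²` on `[−1, 1]`** (equality at `x = 1`). [A. A. Markov 1889; Rivlin §2.7; Mathlib; this file, §1209] -/
theorem abs_eval_derivative_T_real_le (n : ℕ) {x : ℝ} (hx : |x| ≤ 1) : |(derivative (Polynomial.Chebyshev.T ℝ (n : ℤ))).eval x| ≤ (n : ℝ) ^ 2 := by
  have h := Polynomial.Chebyshev.abs_iterate_derivative_T_real_le (n : ℤ) 1 hx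
  rw [Function.iterate_one, Polynomial.Chebyshev.derivative_T_eval_one] at h
  exact_mod_cast h

/-- **V. A. Markov's values: `(∏_{l<k}(2l+1)) |T_n^{(k)}(x)| ≤ ∏_{l<k} (n² − l²)` on `[−1, 1]`.** [V. A. Markov 1892; Rivlin §2.7; Mathlib; this file, §1209] -/
theorem abs_iterate_derivative_T_real_le_explicit (n : ℕ) (k : ℕ) {x : ℝ} (hx : |x| ≤ 1) :
    (∏ l ∈ Finset.range k, (2 * (l : ℝ) + 1)) * |(derivative^[k] (Polynomial.Chebyshev.T ℝ (n : ℤ))).eval x| ≤ ∏ l ∈ Finset.range k, ((n : ℝ) ^ 2 - (l : ℝ) ^ 2) := by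
  have h := Polynomial.Chebyshev.abs_iterate_derivative_T_real_le (n : ℤ) k hx
  have h1 := Polynomial.Chebyshev.iterate_derivative_T_eval_one (R := ℝ) (n : ℤ) k
  push_cast at h1
  rw [← h1]
  exact mul_le_mul_of_nonneg_left h (Finset.prod_nonneg fun l _ => by positivity)

/-- **`|U_n(x)| ≤ min(n + 1, (√(1 − x²))⁻¹)` on `(−1, 1)`** (the bound `n + 1` is the LANDED `Literature.Probability.FitznerVanDerHofstad2017.abs_eval_U_le`, the other is N443).
[Rivlin §1.3; this file, §1209] -/
theorem abs_eval_chebyshevU_real_le_min (n : ℕ) {x : ℝ} (hx : |x| < 1) :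
    |(Polynomial.Chebyshev.U ℝ (n : ℤ)).eval x| ≤ min ((n : ℝ) + 1) (Real.sqrt (1 - x ^ 2))⁻¹ :=
  le_min (Literature.Probability.FitznerVanDerHofstad2017.abs_eval_U_le n hx.le) (abs_eval_chebyshevU_real_le (n : ℤ) hx)

end Summit.Ventures.HSemireg.Wedge.HankelOuter
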